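import Mathlib
import HarnessLib

/-!
# Crux K2 `PoloidalWindowRigidity` (stmt-NavierStokesRegularity-19708), line `z_shock` — GLOBAL (TWO-SIDED) CHARACTERISTICS
# (rung R2, step (0): through every point of `ℝ × ℝ` passes a characteristic defined for ALL heights)

`--supports stmt-NavierStokesRegularity-19708 --as helper` (leafhand-ns-poloidalwindowdoor-1 g0, 2026-08-30).  Class-free ODE lemma,
Mathlib only.  **No stub and no summit is closed by this file; Navier–Stokes regularity is NOT proved here.**

Rung R2 of `Cruxes/PoloidalWindowRigidity/Lines/z_shock.md` applies the two-sided Riccati lemma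
(`…ZShockRiccatiTwoSided`, `…ZShockCharacteristicRiccati.transversal_derivative_eq_zero_along`) along characteristics
`X' = λ(r, s)(z, X)` that must exist for ALL `z ∈ ℝ` (two-sided eternal).  For a `C¹_b` solution the speed
`F(z, x) := λ(r(z,x), s(z,x))` is bounded and uniformly Lipschitz in `x`, and then global characteristics exist through every point:

* `exists_global_solution` — if `F : ℝ → ℝ → ℝ` is continuous in `z` for each `x`, `K`-Lipschitz in `x` for each `z`, and bounded
  by `B`, then for every `(z₀, x₀)` there is `X : ℝ → ℝ` with `X z₀ = x₀` and `X' z = F z (X z)` for ALL `z ∈ ℝ`.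
  Proof: Picard–Lindelöf (`IsPicardLindelof.exists_eq_forall_mem_Icc_hasDerivWithinAt₀`) on `[z₀ − (n+1), z₀ + (n+1)]` with the
  ball of radius `B(n+1) + 1`, for every `n`, and gluing by uniqueness (`ODE_solution_unique_of_mem_Ioo`).
* `exists_global_characteristic` — the specialisation to `F(z,x) = λ(r(z,x), s(z,x))` with `λ ∘ (r,s)` differentiable, bounded,
  and with bounded `x`-derivative (mean value theorem ⇒ Lipschitz).

presearch: Mathlib has local Picard–Lindelöf and uniqueness (`Mathlib.Analysis.ODE.ExistUnique`) but no global-existence corollary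
for bounded Lipschitz fields; tree: `AdditiveNoiseCharacteristics` (one compact interval only). [folklore]
-/

noncomputable section

namespace Summit.NavierStokesRegularity.NavierStokesRegularity.Theorems.PoloidalWindowDoorPoloidalWindowRigidityZShockGlobalCharacteristics

-- the problem directory repeats the summit name (`NavierStokesRegularity/NavierStokesRegularity`)
set_option linter.dupNamespace false

open Set Filter Topology Function Metric
open scoped NNReal

/-- **Global solutions for bounded, uniformly Lipschitz fields.**  Let `F : ℝ → ℝ → ℝ` be continuous in the first variable for
each value of the second, `K`-Lipschitz in the second variable for each value of the first, and bounded by `B`.  Then through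
every `(z₀, x₀)` there is a solution `X` of `X' = F z X` defined on ALL of `ℝ`. [folklore] -/
theorem exists_global_solution {F : ℝ → ℝ → ℝ} {K B : ℝ≥0} (hK : ∀ z, LipschitzWith K (F z))
    (hcont : ∀ x, Continuous fun z => F z x) (hB : ∀ z x, ‖F z x‖ ≤ B) (z₀ x₀ : ℝ) :
    ∃ X : ℝ → ℝ, X z₀ = x₀ ∧ ∀ z, HasDerivAt X (F z (X z)) z := by
  -- Picard–Lindelöf on `[z₀ - (n+1), z₀ + (n+1)]`
  have hPL : ∀ n : ℕ, ∃ α : ℝ → ℝ, α z₀ = x₀ ∧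
      ∀ z ∈ Ioo (z₀ - ((n : ℝ) + 1)) (z₀ + ((n : ℝ) + 1)), HasDerivAt α (F z (α z)) z := by
    intro n
    have hn : (0 : ℝ) < (n : ℝ) + 1 := by positivity
    have hz₀ : z₀ ∈ Icc (z₀ - ((n : ℝ) + 1)) (z₀ + ((n : ℝ) + 1)) := ⟨by linarith, by linarith⟩
    have hpl : IsPicardLindelof F (⟨z₀, hz₀⟩ : Icc (z₀ - ((n : ℝ) + 1)) (z₀ + ((n : ℝ) + 1))) x₀
        (B * ((n : ℝ≥0) + 1) + 1) 0 B K :=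
      { lipschitzOnWith := fun z _ => (hK z).lipschitzOnWith
        continuousOn := fun x _ => (hcont x).continuousOn
        norm_le := fun z _ x _ => hB z x
        mul_max_le := by
          have h1 : max (z₀ + ((n : ℝ) + 1) - z₀) (z₀ - (z₀ - ((n : ℝ) + 1))) = (n : ℝ) + 1 := by
            rw [show z₀ + ((n : ℝ) + 1) - z₀ = (n : ℝ) + 1 by ring,
              show z₀ - (z₀ - ((n : ℝ) + 1)) = (n : ℝ) + 1 by ring, max_self]
          show (B : ℝ) * max (z₀ + ((n : ℝ) + 1) - z₀) (z₀ - (z₀ - ((n : ℝ) + 1))) ≤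
            ((B * ((n : ℝ≥0) + 1) + 1 : ℝ≥0) : ℝ) - ((0 : ℝ≥0) : ℝ)
          rw [h1]; push_cast; linarith }
    obtain ⟨α, hα0, hα⟩ := hpl.exists_eq_forall_mem_Icc_hasDerivWithinAt₀
    exact ⟨α, hα0, fun z hz => (hα z (Ioo_subset_Icc_self hz)).hasDerivAt (Icc_mem_nhds hz.1 hz.2)⟩
  choose α hα0 hα using hPL
  -- the index of a height and the nesting of the intervals
  set N : ℝ → ℕ := fun z => ⌈|z - z₀|⌉₊ with hN
  have hmem : ∀ z, z ∈ Ioo (z₀ - ((N z : ℝ) + 1)) (z₀ + ((N z : ℝ) + 1)) := by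
    intro z
    have h1 : |z - z₀| ≤ (N z : ℝ) := Nat.le_ceil _
    rw [abs_le] at h1
    constructor <;> linarith [h1.1, h1.2]
  have hagree : ∀ m n : ℕ, m ≤ n →
      EqOn (α m) (α n) (Ioo (z₀ - ((m : ℝ) + 1)) (z₀ + ((m : ℝ) + 1))) := by
    intro m n hmn
    have hmn' : (m : ℝ) ≤ n := Nat.cast_le.2 hmn
    have hm : (0 : ℝ) < (m : ℝ) + 1 := by positivity
    have hsub : Ioo (z₀ - ((m : ℝ) + 1)) (z₀ + ((m : ℝ) + 1)) ⊆ Ioo (z₀ - ((n : ℝ) + 1)) (z₀ + ((n : ℝ) + 1)) :=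
      Ioo_subset_Ioo (by linarith) (by linarith)
    exact ODE_solution_unique_of_mem_Ioo (v := F) (s := fun _ => univ) (K := K) (f := α m) (g := α n) (t₀ := z₀)
      (fun z _ => (hK z).lipschitzOnWith) ⟨by linarith, by linarith⟩
      (fun z hz => ⟨hα m z hz, trivial⟩) (fun z hz => ⟨hα n z (hsub hz), trivial⟩)
      (by rw [hα0 m, hα0 n])
  -- the glued solution
  refine ⟨fun z => α (N z) z, hα0 _, fun z => ?_⟩
  have hder : HasDerivAt (α (N z)) (F z (α (N z) z)) z := hα (N z) z (hmem z)
  refine hder.congr_of_eventuallyEq ?_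
  filter_upwards [Ioo_mem_nhds (hmem z).1 (hmem z).2] with z' hz'
  rcases le_total (N z') (N z) with h | h
  · exact hagree _ _ h (hmem z')
  · exact (hagree _ _ h hz').symm

/-- **Global characteristics of a diagonal system.**  If `r, s : ℝ × ℝ → ℝ` and `λ : ℝ × ℝ → ℝ` are such that the speed
`p ↦ λ(r p, s p)` is differentiable, bounded by `B`, and has `x`-derivative bounded by `K` (`x` = second coordinate), then through
every `(z₀, x₀)` passes a GLOBAL characteristic: `X z₀ = x₀`, `X' z = λ(r(z, X z), s(z, X z))` for all `z ∈ ℝ`. [folklore] -/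
theorem exists_global_characteristic {r s : ℝ × ℝ → ℝ} {Λ : ℝ × ℝ → ℝ} {K B : ℝ≥0}
    (hd : Differentiable ℝ fun p : ℝ × ℝ => Λ (r p, s p))
    (hB : ∀ p : ℝ × ℝ, ‖Λ (r p, s p)‖ ≤ B)
    (hKx : ∀ p : ℝ × ℝ, ‖fderiv ℝ (fun q : ℝ × ℝ => Λ (r q, s q)) p (0, 1)‖ ≤ K) (z₀ x₀ : ℝ) :
    ∃ X : ℝ → ℝ, X z₀ = x₀ ∧ ∀ z, HasDerivAt X (Λ (r (z, X z), s (z, X z))) z := by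
  set F : ℝ → ℝ → ℝ := fun z x => Λ (r (z, x), s (z, x)) with hF
  -- each slice `x ↦ F z x` is differentiable with derivative the `x`-partial, hence `K`-Lipschitz
  have hslice : ∀ z x, HasDerivAt (F z) (fderiv ℝ (fun q : ℝ × ℝ => Λ (r q, s q)) (z, x) (0, 1)) x := by
    intro z x
    have hγ : HasDerivAt (fun x' : ℝ => ((z, x') : ℝ × ℝ)) ((0 : ℝ), (1 : ℝ)) x :=
      (hasDerivAt_const x z).prodMk (hasDerivAt_id x)
    exact (hd (z, x)).hasFDerivAt.comp_hasDerivAt x hγ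
  have hK' : ∀ z, LipschitzWith K (F z) := by
    intro z
    refine lipschitzWith_of_nnnorm_deriv_le (fun x => (hslice z x).differentiableAt) fun x => ?_
    rw [(hslice z x).deriv]
    exact_mod_cast hKx (z, x)
  have hcont : ∀ x, Continuous fun z => F z x := by
    intro x
    exact hd.continuous.comp (continuous_id.prodMk continuous_const)
  exact exists_global_solution hK' hcont (fun z x => hB (z, x)) z₀ x₀

end Summit.NavierStokesRegularity.NavierStokesRegularity.Theorems.PoloidalWindowDoorPoloidalWindowRigidityZShockGlobalCharacteristics

end
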